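import Literature.Barriers.RiemannHypothesis.EpsteinZetaThetaDecomposition
import Literature.Analysis.SpecialFunctions.BesselK0IntegralBound
import HarnessLib

/-!
# The central value of the Epstein zeta function, exactly: `Re Λ_z(½) = 2√y(γ + log y − log 4π) + 4√y Σ_{m,k≥1} cos(2πxmk) I(πymk)`

Proof file (no definitions; everything is proved), continuing
`EpsteinZetaThetaDecomposition.lean`. For `z = x + iy ∈ ℍ` and the Mellin transform
`Λ_z = Λ₀,z − 1/s − 1/(1 − s)` of the theta series of `ℤz + ℤ`
(`Literature.NumberTheory.Automorphic.thetaFEPair`; `Λ_z(½)` is real, and for the form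
`Q = ax² + bxy + cy²` with `z = b/(2a) + ik` one has `Λ_z(½) = 2√k·a^{½}Z(½)`,
`EpsteinZetaCentralValue.continuation_ofReal_eq`), the main theorem `re_Λ_half_eq_exact` is

`Re Λ_z(½) = 2√y (γ + log y − log 4π) + 4√y Σ_{m,k≥1} cos(2πxmk) ∫₀^∞ t⁻¹ e^{−πymk(t + 1/t)} dt`,

i.e. Bateman–Grosswald's `a^{½}Z(½) = γ + log k − log 4π + H(½)` with
`H(½) = 4 Σ_n σ₀(n) cos(nπb/a) K₀(2πkn)` ((3)–(4) at `s = ½` and the value `γ + log k − log 4π` of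
`f(s) + f(1 − s)` at `s = ½`, p. 372), the `K`-Bessel function entering as
`∫₀^∞ t⁻¹e^{−κ(t+1/t)}dt = 2K₀(2κ)`. Steps:

1. `hasMellin_H` — for EVERY `y > 0`, the one-variable piece
   `H_y = 𝟙_{(1/y,∞)}(ϑ − 1) + 𝟙_{(0,1/y)}(ϑ − u^{−1/2})` has
   `mellin H_y (½) = 2·completedRiemannZeta₀(1) + (log y − 2 + 2/√y)`: `H_y − f̃^H` is, off the two
   points `1, 1/y`, the elementary `±𝟙(u⁻¹ − u^{−1/2})u^{1/2}` between `1/y` and `1`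
   (`cpow_smul_H_sub_f_modif`), with integral `∫_{1/y}^1 (u⁻¹ − u^{−1/2}) du = log y − 2 + 2/√y`;
   and `Λ₀^H(½) = 2·completedRiemannZeta₀(1)` has real part `2 + γ − log 4π` (Mathlib's
   `completedRiemannZeta₀_one`, via `EpsteinZetaCentralValueSharp.re_two_mul_completedRiemannZeta₀_one`).
2. `cross_term_integral`, `summable_cross_norms` — the cross terms: after the weight `t^{−1/2}`,
   each is `4√y cos(2πxmk) · t⁻¹e^{−(πym²t + πyk²/t)}`, with integral `4√y cos(2πxmk) I(πymk)` by the
   scaling of `BesselK0IntegralBound` (`I(κ) = ∫₀^∞ t⁻¹e^{−κ(t+1/t)}dt`), and the norms are summable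
   by `I(κ) ≤ √(π/κ)e^{−2κ}` and `mk ≥ m + k − 1`; so Fubini applies
   (`MeasureTheory.integral_tsum_of_summable_integral_norm`).
3. `re_Λ_half_eq_exact` — `f̃_z = H_y(·/y) + t⁻¹H_y(1/(ty)) + C` a.e. (`re_f_modif_decomposition`),
   the two copies of `H_y` have Mellin transform `√y·mellin H_y(½)` each
   (`EpsteinZetaCentralValueSharp.mellin_comp_inv_mul`, `.mellin_inv_mul_comp_inv`), hence
   `Λ₀,z(½) = 2√y(2 + γ − log 4π + log y − 2 + 2/√y) + 4√y S = 2√y(γ + log y − log 4π) + 4 + 4√y S`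
   and `Λ_z(½) = Λ₀,z(½) − 4`.

## References

* [BatemanGrosswald1964] P. T. Bateman, E. Grosswald, *On Epstein's zeta function*, Acta Arith. 9
  (1964) 365–373, Theorem 1 (3)–(4), (15)–(18), (21) and p. 372 (read from the page images of the
  held scan `doi-10-4064-aa-9-4-365-373`).
* [MontgomeryVaughan2007] §10.1 Exercise 25 (the theta-function continuation `Λ_z`).
-/

noncomputable section

open Complex Filter Topology MeasureTheory Set HurwitzZeta
open scoped UpperHalfPlane

namespace Literature.Barriers.RiemannHypothesis

open Literature.NumberTheory.Automorphic

/-! ## The Mellin transform of `H_y` at `½`: `Λ₀^H(½) + (log y − 2 + 2/√y)` -/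

/-- `∫_{1/y}^1 (u⁻¹ − u^{−1/2}) du = log y − 2 + 2/√y` for every `y > 0` (oriented interval
integral; `EpsteinZetaCentralValueSharp.integral_inv_sub_rpow` is the case `y ≥ 1`). [folklore] -/
theorem integral_inv_sub_rpow_of_pos {y : ℝ} (hy : 0 < y) :
    ∫ u in (1 / y : ℝ)..1, (u⁻¹ - u ^ (-(1 / 2 : ℝ))) = Real.log y - 2 + 2 / Real.sqrt y := by
  have hiy : 0 < 1 / y := one_div_pos.2 hy
  have hmem : ∀ t ∈ uIcc (1 / y : ℝ) 1, 0 < t := fun t ht => by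
    rcases Set.mem_uIcc.1 ht with ⟨h1, _⟩ | ⟨h1, _⟩ <;> linarith
  have hc1 : ContinuousOn (fun t : ℝ => t⁻¹) (uIcc (1 / y) 1) :=
    continuousOn_inv₀.mono fun t ht => (hmem t ht).ne'
  have hc2 : ContinuousOn (fun t : ℝ => t ^ (-(1 / 2 : ℝ))) (uIcc (1 / y) 1) :=
    ContinuousOn.rpow_const continuousOn_id fun t ht => Or.inl (hmem t ht).ne'
  rw [intervalIntegral.integral_sub hc1.intervalIntegrable hc2.intervalIntegrable,
    integral_inv_of_pos hiy one_pos, one_div_one_div, integral_rpow (Or.inl (by norm_num)),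
    Real.one_rpow, show -(1 / 2 : ℝ) + 1 = 1 / 2 by norm_num, one_div y,
    Real.inv_rpow hy.le, ← Real.sqrt_eq_rpow]
  field_simp
  ring

/-- Outside the two points `1` and `1/y`, the weighted difference `u^{−1/2}(H_y − f̃^H)` is the
elementary function `d_y = 𝟙_{(1/y,1)}(u⁻¹ − u^{−1/2}) − 𝟙_{(1,1/y)}(u⁻¹ − u^{−1/2})` (one of the two
intervals is empty). [folklore] -/
theorem cpow_smul_H_sub_f_modif {y : ℝ} (hy : 0 < y) {H : ℝ → ℝ}
    (hH : H = fun u => (Ioi (1 / y)).indicator (fun u => evenKernel 0 u - 1) u +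
      (Ioo 0 (1 / y)).indicator (fun u => evenKernel 0 u - u ^ (-(1 / 2 : ℝ))) u)
    {u : ℝ} (hu : 0 < u) (hu1 : u ≠ 1) (huy : u ≠ 1 / y) :
    (u : ℂ) ^ ((1 / 2 : ℂ) - 1) • (((H u : ℝ) : ℂ) - (hurwitzEvenFEPair 0).f_modif u) =
      (((Ioo (1 / y) 1).indicator (fun u : ℝ => u⁻¹ - u ^ (-(1 / 2 : ℝ))) u -
        (Ioo 1 (1 / y)).indicator (fun u : ℝ => u⁻¹ - u ^ (-(1 / 2 : ℝ))) u : ℝ) : ℂ) := by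
  have hiy : 0 < 1 / y := one_div_pos.2 hy
  have hpow : (u : ℂ) ^ ((1 / 2 : ℂ) - 1) = ((u ^ (-(1 / 2 : ℝ)) : ℝ) : ℂ) := by
    rw [show (1 / 2 : ℂ) - 1 = ((-(1 / 2 : ℝ) : ℝ) : ℂ) by push_cast; ring, Complex.ofReal_cpow hu.le]
  have hsq : u ^ (-(1 / 2 : ℝ)) * u ^ (-(1 / 2 : ℝ)) = u⁻¹ := by
    rw [← Real.rpow_add hu, ← Real.rpow_neg_one]; norm_num
  -- the value of `H u − f̃^H u` as a real number
  have hval : ((H u : ℝ) : ℂ) - (hurwitzEvenFEPair 0).f_modif u =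
      (((Ioi (1 / y)).indicator (fun u => evenKernel 0 u - 1) u +
        (Ioo 0 (1 / y)).indicator (fun u => evenKernel 0 u - u ^ (-(1 / 2 : ℝ))) u -
        ((Ioi 1).indicator (fun u => evenKernel 0 u - 1) u +
          (Ioo 0 1).indicator (fun u => evenKernel 0 u - u ^ (-(1 / 2 : ℝ))) u) : ℝ) : ℂ) := by
    rw [hH, f_modif_hurwitz_zero]
    push_cast
    congr 1
    by_cases h1 : u ∈ Ioi (1 : ℝ)
    · have h2 : u ∉ Ioo (0 : ℝ) 1 := fun h => lt_irrefl _ (h.2.trans h1)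
      rw [indicator_of_mem h1, indicator_of_notMem h2, indicator_of_mem h1, indicator_of_notMem h2]
      push_cast; ring
    · have h2 : u ∈ Ioo (0 : ℝ) 1 := ⟨hu, lt_of_le_of_ne (not_lt.1 h1) hu1⟩
      rw [indicator_of_notMem h1, indicator_of_mem h2, indicator_of_notMem h1, indicator_of_mem h2]
      push_cast; ring
  rw [hpow, hval, smul_eq_mul, ← Complex.ofReal_mul]
  congr 1
  -- four cases for the position of `u`
  rcases lt_or_gt_of_ne hu1 with h1 | h1
  · -- `u < 1`
    have hn1 : u ∉ Ioi (1 : ℝ) := fun h => lt_irrefl _ (h1.trans h)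
    have hm1 : u ∈ Ioo (0 : ℝ) 1 := ⟨hu, h1⟩
    have hn2 : u ∉ Ioo 1 (1 / y) := fun h => lt_irrefl _ (h1.trans h.1)
    rw [indicator_of_notMem hn1, indicator_of_mem hm1, indicator_of_notMem hn2, zero_add, sub_zero]
    rcases lt_or_gt_of_ne huy with h2 | h2
    · have hn3 : u ∉ Ioi (1 / y) := fun h => lt_irrefl _ (h2.trans h)
      have hm3 : u ∈ Ioo 0 (1 / y) := ⟨hu, h2⟩
      have hn4 : u ∉ Ioo (1 / y) 1 := fun h => lt_irrefl _ (h2.trans h.1)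
      rw [indicator_of_notMem hn3, indicator_of_mem hm3, indicator_of_notMem hn4]
      ring
    · have hm3 : u ∈ Ioi (1 / y) := h2
      have hn3 : u ∉ Ioo 0 (1 / y) := fun h => lt_irrefl _ (h2.trans h.2)
      have hm4 : u ∈ Ioo (1 / y) 1 := ⟨h2, h1⟩
      rw [indicator_of_mem hm3, indicator_of_notMem hn3, indicator_of_mem hm4]
      linear_combination hsq
  · -- `u > 1`
    have hm1 : u ∈ Ioi (1 : ℝ) := h1
    have hn1 : u ∉ Ioo (0 : ℝ) 1 := fun h => lt_irrefl _ (h1.trans h.2)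
    have hn2 : u ∉ Ioo (1 / y) 1 := fun h => lt_irrefl _ (h1.trans h.2)
    rw [indicator_of_mem hm1, indicator_of_notMem hn1, indicator_of_notMem hn2, add_zero, zero_sub]
    rcases lt_or_gt_of_ne huy with h2 | h2
    · have hn3 : u ∉ Ioi (1 / y) := fun h => lt_irrefl _ (h2.trans h)
      have hm3 : u ∈ Ioo 0 (1 / y) := ⟨hu, h2⟩
      have hm4 : u ∈ Ioo 1 (1 / y) := ⟨h1, h2⟩
      rw [indicator_of_notMem hn3, indicator_of_mem hm3, indicator_of_mem hm4, neg_sub]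
      linear_combination (-1 : ℝ) * hsq
    · have hm3 : u ∈ Ioi (1 / y) := h2
      have hn3 : u ∉ Ioo 0 (1 / y) := fun h => lt_irrefl _ (h2.trans h.2)
      have hn4 : u ∉ Ioo 1 (1 / y) := fun h => lt_irrefl _ (h2.trans h.2)
      rw [indicator_of_mem hm3, indicator_of_notMem hn3, indicator_of_notMem hn4]
      ring

/-- Off finitely many points: `u ≠ 1 ∧ u ≠ 1/y` holds a.e. for Lebesgue measure restricted to
`(0, ∞)`. [folklore] -/
theorem ae_ne_two_points (y : ℝ) :
    ∀ᵐ u ∂(volume.restrict (Ioi (0 : ℝ))), u ≠ 1 ∧ u ≠ 1 / y := by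
  have h : ∀ᵐ u ∂(volume : Measure ℝ), u ≠ 1 ∧ u ≠ 1 / y := by
    have h1 : ∀ᵐ u ∂(volume : Measure ℝ), u ≠ 1 := by
      rw [ae_iff]; simp
    have h2 : ∀ᵐ u ∂(volume : Measure ℝ), u ≠ 1 / y := by
      rw [ae_iff]; simp
    exact h1.and h2
  exact ae_restrict_of_ae h

/-- **`mellin H_y (½) = 2·completedRiemannZeta₀(1) + (log y − 2 + 2/√y)`** for every `y > 0`
(`2·completedRiemannZeta₀(1) = Λ₀^H(½)` has real part `2 + γ − log 4π`), and the transform converges.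
[folklore] -/
theorem hasMellin_H {y : ℝ} (hy : 0 < y) {H : ℝ → ℝ}
    (hH : H = fun u => (Ioi (1 / y)).indicator (fun u => evenKernel 0 u - 1) u +
      (Ioo 0 (1 / y)).indicator (fun u => evenKernel 0 u - u ^ (-(1 / 2 : ℝ))) u) :
    HasMellin (fun u => ((H u : ℝ) : ℂ)) (1 / 2)
      (2 * completedRiemannZeta₀ 1 + ((Real.log y - 2 + 2 / Real.sqrt y : ℝ) : ℂ)) := by
  have hiy : 0 < 1 / y := one_div_pos.2 hy
  set P := hurwitzEvenFEPair 0 with hP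
  have hconv : MellinConvergent P.f_modif (1 / 2) := (P.isStrongFEPair_toStrongFEPair.hasMellin (1 / 2)).1
  -- the difference `D = H − f̃^H` and the elementary `d`
  set D : ℝ → ℂ := fun u => ((H u : ℝ) : ℂ) - P.f_modif u with hD
  set d : ℝ → ℝ := fun u => (Ioo (1 / y) 1).indicator (fun u : ℝ => u⁻¹ - u ^ (-(1 / 2 : ℝ))) u -
    (Ioo 1 (1 / y)).indicator (fun u : ℝ => u⁻¹ - u ^ (-(1 / 2 : ℝ))) u with hd
  have hDd : ∀ᵐ u : ℝ ∂(volume.restrict (Ioi (0 : ℝ))),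
      ((u : ℝ) : ℂ) ^ ((1 / 2 : ℂ) - 1) • D u = ((d u : ℝ) : ℂ) := by
    filter_upwards [ae_ne_two_points y, ae_restrict_mem measurableSet_Ioi] with u hu hu0
    exact cpow_smul_H_sub_f_modif hy hH hu0 hu.1 hu.2
  -- integrability of `d`
  have hpiece : ∀ {a b : ℝ}, 0 < a → Integrable ((Ioo a b).indicator fun u : ℝ => u⁻¹ - u ^ (-(1 / 2 : ℝ))) := by
    intro a b ha
    have hpos : ∀ t ∈ Icc a b, (0 : ℝ) < t := fun t ht => lt_of_lt_of_le ha ht.1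
    have hcA : ContinuousOn (fun u : ℝ => u⁻¹ - u ^ (-(1 / 2 : ℝ))) (Icc a b) :=
      (continuousOn_inv₀.mono fun t ht => (hpos t ht).ne').sub
        (ContinuousOn.rpow_const continuousOn_id fun t ht => Or.inl (hpos t ht).ne')
    exact (integrable_indicator_iff measurableSet_Ioo).2 ((hcA.integrableOn_Icc).mono_set Ioo_subset_Icc_self)
  have hIA := hpiece (b := 1) hiy
  have hIB := hpiece (b := 1 / y) one_pos
  have hdint : Integrable d := hIA.sub hIB
  -- hence `D` is Mellin-convergent at `½`, with transform `∫ d`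
  have hDconv : MellinConvergent D (1 / 2) := by
    have h1 : IntegrableOn (fun u : ℝ => ((d u : ℝ) : ℂ)) (Ioi 0) := hdint.ofReal.integrableOn
    exact h1.congr_fun_ae (Filter.EventuallyEq.symm hDd)
  have hDmellin : mellin D (1 / 2) = ((∫ u in Ioi (0 : ℝ), d u : ℝ) : ℂ) := by
    unfold mellin
    rw [integral_congr_ae hDd]
    exact integral_ofReal
  -- the value of `∫ d`
  have hdval : ∫ u in Ioi (0 : ℝ), d u = Real.log y - 2 + 2 / Real.sqrt y := by
    rw [← integral_inv_sub_rpow_of_pos hy]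
    simp only [hd]
    rw [integral_sub hIA.integrableOn hIB.integrableOn, setIntegral_indicator measurableSet_Ioo,
      setIntegral_indicator measurableSet_Ioo,
      show Ioi (0 : ℝ) ∩ Ioo (1 / y) 1 = Ioo (1 / y) 1 from inter_eq_right.2 fun t ht => lt_trans hiy ht.1,
      show Ioi (0 : ℝ) ∩ Ioo 1 (1 / y) = Ioo 1 (1 / y) from inter_eq_right.2 fun t ht => lt_trans one_pos ht.1]
    rcases le_or_gt (1 / y) 1 with h | h
    · rw [Set.Ioo_eq_empty (fun h' => not_lt.2 h h'), Measure.restrict_empty, integral_zero_measure,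
        sub_zero, ← integral_Ioc_eq_integral_Ioo, ← intervalIntegral.integral_of_le h]
    · rw [Set.Ioo_eq_empty (fun h' => lt_asymm h h'), Measure.restrict_empty, integral_zero_measure,
        zero_sub, ← integral_Ioc_eq_integral_Ioo, ← intervalIntegral.integral_of_le h.le,
        intervalIntegral.integral_symm, neg_neg]
  -- assemble: `H = f̃^H + D`
  have hsum := hasMellin_add hconv hDconv
  have e : (fun t => P.f_modif t + D t) = fun u => ((H u : ℝ) : ℂ) := by
    funext u; simp only [hD]; ring
  rw [e] at hsum
  refine ⟨hsum.1, ?_⟩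
  rw [hsum.2, hDmellin, hdval, show mellin P.f_modif (1 / 2) = 2 * completedRiemannZeta₀ 1 from
    mellin_f_modif_hurwitz_half]


/-! ## The cross terms: termwise Mellin transforms and Fubini -/

/-- `√(πy(m+1)² · πy(k+1)²) = πy(m+1)(k+1)`. [folklore] -/
theorem sqrt_cross_product {y : ℝ} (hy : 0 < y) (m k : ℕ) :
    Real.sqrt (Real.pi * y * ((m : ℝ) + 1) ^ 2 * (Real.pi * y * ((k : ℝ) + 1) ^ 2)) =
      Real.pi * y * ((m : ℝ) + 1) * ((k : ℝ) + 1) := by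
  rw [show Real.pi * y * ((m : ℝ) + 1) ^ 2 * (Real.pi * y * ((k : ℝ) + 1) ^ 2) =
    (Real.pi * y * ((m : ℝ) + 1) * ((k : ℝ) + 1)) ^ 2 by ring]
  exact Real.sqrt_sq (mul_nonneg (mul_nonneg (mul_nonneg Real.pi_pos.le hy.le) (by positivity))
    (by positivity))

/-- Termwise: `t^{−1/2} · 4√(y/t) e^{−πy(t(m+1)² + (k+1)²/t)} c = 4√y · t⁻¹ e^{−(At + B/t)} · c` with
`A = πy(m+1)²`, `B = πy(k+1)²` (`t > 0`). [folklore] -/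
theorem cross_term_eq {y t : ℝ} (ht : 0 < t) (m k : ℕ) (c : ℝ) :
    t ^ ((1 / 2 : ℝ) - 1) * (4 * Real.sqrt (y / t) *
        (Real.exp (-Real.pi * y * (t * ((m : ℝ) + 1) ^ 2 + ((k : ℝ) + 1) ^ 2 / t)) * c)) =
      4 * Real.sqrt y * (t⁻¹ * Real.exp (-(Real.pi * y * ((m : ℝ) + 1) ^ 2 * t +
        Real.pi * y * ((k : ℝ) + 1) ^ 2 * t⁻¹))) * c := by
  have hpow : t ^ ((1 / 2 : ℝ) - 1) = (Real.sqrt t)⁻¹ := by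
    rw [show (1 / 2 : ℝ) - 1 = -(1 / 2) by norm_num, Real.rpow_neg ht.le, Real.sqrt_eq_rpow]
  have hst : (Real.sqrt t)⁻¹ * Real.sqrt (y / t) = Real.sqrt y * t⁻¹ := by
    rw [Real.sqrt_div' y ht.le, inv_mul_eq_div, div_div, Real.mul_self_sqrt ht.le, div_eq_mul_inv]
  have hexp : Real.exp (-Real.pi * y * (t * ((m : ℝ) + 1) ^ 2 + ((k : ℝ) + 1) ^ 2 / t)) =
      Real.exp (-(Real.pi * y * ((m : ℝ) + 1) ^ 2 * t + Real.pi * y * ((k : ℝ) + 1) ^ 2 * t⁻¹)) := by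
    congr 1; rw [div_eq_mul_inv]; ring
  rw [hpow, hexp, show ∀ E : ℝ, (Real.sqrt t)⁻¹ * (4 * Real.sqrt (y / t) * (E * c)) =
    4 * ((Real.sqrt t)⁻¹ * Real.sqrt (y / t)) * (E * c) from fun E => by ring, hst]
  ring

/-- **The Mellin transform of one cross term**: with `A = πy(m+1)²`, `B = πy(k+1)²`,
`κ = πy(m+1)(k+1)`, the function `4√y · t⁻¹e^{−(At + B/t)} · c` is integrable on `(0, ∞)`, its
integral is `4√y · c · I(κ)` and the integral of its norm is `4√y · |c| · I(κ)`,
`I(κ) = ∫₀^∞ t⁻¹ e^{−κ(t + 1/t)} dt` (`BesselK0IntegralBound.lean`). [folklore] -/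
theorem cross_term_integral {y : ℝ} (hy : 0 < y) (m k : ℕ) (c : ℝ) :
    IntegrableOn (fun t : ℝ => 4 * Real.sqrt y * (t⁻¹ * Real.exp (-(Real.pi * y * ((m : ℝ) + 1) ^ 2 * t +
        Real.pi * y * ((k : ℝ) + 1) ^ 2 * t⁻¹))) * c) (Ioi 0) ∧
    (∫ t in Ioi (0 : ℝ), 4 * Real.sqrt y * (t⁻¹ * Real.exp (-(Real.pi * y * ((m : ℝ) + 1) ^ 2 * t +
        Real.pi * y * ((k : ℝ) + 1) ^ 2 * t⁻¹))) * c) =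
      4 * Real.sqrt y * c * ∫ t in Ioi (0 : ℝ),
        t⁻¹ * Real.exp (-(Real.pi * y * ((m : ℝ) + 1) * ((k : ℝ) + 1)) * (t + t⁻¹)) ∧
    (∫ t in Ioi (0 : ℝ), ‖4 * Real.sqrt y * (t⁻¹ * Real.exp (-(Real.pi * y * ((m : ℝ) + 1) ^ 2 * t +
        Real.pi * y * ((k : ℝ) + 1) ^ 2 * t⁻¹))) * c‖) =
      4 * Real.sqrt y * |c| * ∫ t in Ioi (0 : ℝ),
        t⁻¹ * Real.exp (-(Real.pi * y * ((m : ℝ) + 1) * ((k : ℝ) + 1)) * (t + t⁻¹)) := by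
  have hA : 0 < Real.pi * y * ((m : ℝ) + 1) ^ 2 := by positivity
  have hB : 0 < Real.pi * y * ((k : ℝ) + 1) ^ 2 := by positivity
  obtain ⟨hint, heq⟩ := Literature.Analysis.SpecialFunctions.BesselK0.integral_inv_mul_exp_neg_add_div hA hB
  rw [sqrt_cross_product hy m k] at heq
  refine ⟨(hint.const_mul _).mul_const _, ?_, ?_⟩
  · rw [integral_mul_const, integral_const_mul, heq]; ring
  · have hpt : ∀ t ∈ Ioi (0 : ℝ), ‖4 * Real.sqrt y * (t⁻¹ * Real.exp (-(Real.pi * y * ((m : ℝ) + 1) ^ 2 * t +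
        Real.pi * y * ((k : ℝ) + 1) ^ 2 * t⁻¹))) * c‖ =
        (4 * Real.sqrt y * |c|) * (t⁻¹ * Real.exp (-(Real.pi * y * ((m : ℝ) + 1) ^ 2 * t +
          Real.pi * y * ((k : ℝ) + 1) ^ 2 * t⁻¹))) := fun t ht => by
      have ht0 : (0 : ℝ) < t := ht
      rw [Real.norm_eq_abs, abs_mul, abs_mul, abs_of_nonneg (by positivity : (0:ℝ) ≤ 4 * Real.sqrt y),
        abs_of_nonneg (by positivity : (0:ℝ) ≤ t⁻¹ * Real.exp (-(Real.pi * y * ((m : ℝ) + 1) ^ 2 * t +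
          Real.pi * y * ((k : ℝ) + 1) ^ 2 * t⁻¹)))]
      ring
    rw [setIntegral_congr_fun measurableSet_Ioi hpt, integral_const_mul, heq]

/-- **Summability of the termwise norms** `4√y |cos(2πx(m+1)(k+1))| I(πy(m+1)(k+1))` over
`ℕ × ℕ` (by `I(κ) ≤ √(π/κ)e^{−2κ}` and `(m+1)(k+1) ≥ 1 + m + k`). [folklore] -/
theorem summable_cross_norms {y : ℝ} (hy : 0 < y) (x : ℝ) :
    Summable fun p : ℕ × ℕ => 4 * Real.sqrt y * |Real.cos (2 * Real.pi * x * ((p.1 : ℝ) + 1) * ((p.2 : ℝ) + 1))| *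
      ∫ t in Ioi (0 : ℝ), t⁻¹ * Real.exp (-(Real.pi * y * ((p.1 : ℝ) + 1) * ((p.2 : ℝ) + 1)) * (t + t⁻¹)) := by
  set a : ℝ := -(2 * Real.pi * y) with ha
  have ha0 : a < 0 := by rw [ha]; have := Real.pi_pos; nlinarith
  have hgeo : Summable fun n : ℕ => Real.exp ((n : ℝ) * a) := Real.summable_exp_nat_mul_iff.2 ha0
  have hprod := hgeo.mul_of_nonneg hgeo (fun _ => (Real.exp_pos _).le) (fun _ => (Real.exp_pos _).le)
  have hmaj := hprod.mul_left (4 * Real.sqrt y * (Real.sqrt (1 / y) * Real.exp (-(2 * Real.pi * y))))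
  refine Summable.of_nonneg_of_le (fun p => ?_) (fun p => ?_) hmaj
  · have := (Literature.Analysis.SpecialFunctions.BesselK0.integral_inv_mul_exp_pos
      (κ := Real.pi * y * ((p.1 : ℝ) + 1) * ((p.2 : ℝ) + 1)) (by positivity)).le
    positivity
  · have hκ : 0 < Real.pi * y * ((p.1 : ℝ) + 1) * ((p.2 : ℝ) + 1) := by positivity
    have hI := Literature.Analysis.SpecialFunctions.BesselK0.integral_inv_mul_exp_le hκ
    have hm : (0 : ℝ) ≤ p.1 := Nat.cast_nonneg _
    have hk : (0 : ℝ) ≤ p.2 := Nat.cast_nonneg _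
    -- `√(π/κ) ≤ √(1/y)`
    have h1 : Real.sqrt (Real.pi / (Real.pi * y * ((p.1 : ℝ) + 1) * ((p.2 : ℝ) + 1))) ≤ Real.sqrt (1 / y) := by
      apply Real.sqrt_le_sqrt
      rw [div_le_div_iff₀ hκ hy]
      have hπ := Real.pi_pos
      nlinarith [mul_nonneg hm hk, mul_pos hπ hy]
    -- `e^{−2κ} ≤ e^{−2πy} e^{ma} e^{ka}`
    have h2 : Real.exp (-(2 * (Real.pi * y * ((p.1 : ℝ) + 1) * ((p.2 : ℝ) + 1)))) ≤
        Real.exp (-(2 * Real.pi * y)) * (Real.exp ((p.1 : ℝ) * a) * Real.exp ((p.2 : ℝ) * a)) := by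
      rw [← Real.exp_add, ← Real.exp_add, ha]
      refine Real.exp_le_exp.2 ?_
      have hπ := Real.pi_pos
      nlinarith [mul_nonneg hm hk, mul_pos hπ hy]
    have hcos : |Real.cos (2 * Real.pi * x * ((p.1 : ℝ) + 1) * ((p.2 : ℝ) + 1))| ≤ 1 := Real.abs_cos_le_one _
    have hIpos := (Literature.Analysis.SpecialFunctions.BesselK0.integral_inv_mul_exp_pos hκ).le
    calc 4 * Real.sqrt y * |Real.cos (2 * Real.pi * x * ((p.1 : ℝ) + 1) * ((p.2 : ℝ) + 1))| *
          ∫ t in Ioi (0 : ℝ), t⁻¹ * Real.exp (-(Real.pi * y * ((p.1 : ℝ) + 1) * ((p.2 : ℝ) + 1)) * (t + t⁻¹))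
        ≤ 4 * Real.sqrt y * 1 * (Real.sqrt (Real.pi / (Real.pi * y * ((p.1 : ℝ) + 1) * ((p.2 : ℝ) + 1))) *
            Real.exp (-(2 * (Real.pi * y * ((p.1 : ℝ) + 1) * ((p.2 : ℝ) + 1))))) := by
          gcongr
      _ ≤ 4 * Real.sqrt y * 1 * (Real.sqrt (1 / y) *
            (Real.exp (-(2 * Real.pi * y)) * (Real.exp ((p.1 : ℝ) * a) * Real.exp ((p.2 : ℝ) * a)))) := by
          gcongr
      _ = 4 * Real.sqrt y * (Real.sqrt (1 / y) * Real.exp (-(2 * Real.pi * y))) *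
            (Real.exp ((p.1 : ℝ) * a) * Real.exp ((p.2 : ℝ) * a)) := by ring


/-! ## Assembly: the exact central value `Λ_z(½)` -/

/-- `f̃_z(t)` is real. [folklore] -/
theorem f_modif_thetaFEPair_im (z : ℍ) (t : ℝ) : ((thetaFEPair z).f_modif t).im = 0 := by
  rw [f_modif_thetaFEPair]
  by_cases h1 : t ∈ Ioi (1 : ℝ)
  · have h2 : t ∉ Ioo (0 : ℝ) 1 := fun h => lt_irrefl _ (h.2.trans h1)
    rw [indicator_of_mem h1, indicator_of_notMem h2]; simp
  · rw [indicator_of_notMem h1]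
    by_cases h2 : t ∈ Ioo (0 : ℝ) 1
    · rw [indicator_of_mem h2]; simp
    · rw [indicator_of_notMem h2]; simp

/-- `f̃_z(t) = Re f̃_z(t)` as a complex number. [folklore] -/
theorem f_modif_thetaFEPair_eq_ofReal (z : ℍ) (t : ℝ) :
    (thetaFEPair z).f_modif t = ((((thetaFEPair z).f_modif t).re : ℝ) : ℂ) := by
  apply Complex.ext
  · simp
  · simp [f_modif_thetaFEPair_im]

/-- **The central value of the Epstein zeta function, exactly** (Bateman–Grosswald's (9) with the
error term written out rather than estimated). For `z = x + iy ∈ ℍ` and the Mellin transform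
`Λ_z` of the theta series of `ℤz + ℤ` (`Literature.NumberTheory.Automorphic.thetaFEPair`):
`Re Λ_z(½) = 2√y (γ + log y − log 4π) + 4√y Σ_{m,k≥1} cos(2πxmk) ∫₀^∞ t⁻¹ e^{−πymk(t + 1/t)} dt`
(the integral is `2K₀(2πymk)`; `Λ_z(½)` is real, `im_Λ_ofReal`). Through
`Λ_z(½) = 2√k · a^{½} Z(½)` (`continuation_ofReal_eq`, `z = b/(2a) + ik`) this is
`a^{½}Z(½) = γ + log k − log 4π + H(½)`, `H(½) = 4 Σ_n σ₀(n) cos(nπb/a) K₀(2πkn)` — (3)–(4) at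
`s = ½` together with the evaluation `γ + log k − log 4π` of `f(s) + f(1−s)` at `s = ½` (p. 372).
Proof: `thetaQ_decomposition` (Poisson summation in one variable), the Mellin bookkeeping
`mellin[H_y(·/y)](½) = mellin[t⁻¹H_y(1/(ty))](½) = √y·mellin H_y(½)`, `hasMellin_H`
(`Λ₀^H(½) = 2 + γ − log 4π`, Mathlib's `completedRiemannZeta₀_one`), and Fubini for the cross terms.
[cite: BatemanGrosswald1964, Theorem 1 (3)–(4) and p. 372] -/
theorem re_Λ_half_eq_exact (z : ℍ) :
    ((thetaFEPair z).Λ ((1 / 2 : ℝ) : ℂ)).re =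
      2 * Real.sqrt z.im * (Real.eulerMascheroniConstant + Real.log z.im - Real.log (4 * Real.pi)) +
      4 * Real.sqrt z.im * ∑' p : ℕ × ℕ, Real.cos (2 * Real.pi * z.re * ((p.1 : ℝ) + 1) * ((p.2 : ℝ) + 1)) *
        ∫ t in Ioi (0 : ℝ), t⁻¹ * Real.exp (-(Real.pi * z.im * ((p.1 : ℝ) + 1) * ((p.2 : ℝ) + 1)) * (t + t⁻¹)) := by
  have hy : 0 < z.im := z.im_pos
  have hsy : 0 < Real.sqrt z.im := Real.sqrt_pos.2 hy
  set S : ℝ := ∑' p : ℕ × ℕ, Real.cos (2 * Real.pi * z.re * ((p.1 : ℝ) + 1) * ((p.2 : ℝ) + 1)) *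
    ∫ t in Ioi (0 : ℝ), t⁻¹ * Real.exp (-(Real.pi * z.im * ((p.1 : ℝ) + 1) * ((p.2 : ℝ) + 1)) * (t + t⁻¹))
    with hS
  -- the one-variable function `H_y` and its Mellin transform
  set H : ℝ → ℝ := fun u => (Ioi (1 / z.im)).indicator (fun u => evenKernel 0 u - 1) u +
      (Ioo 0 (1 / z.im)).indicator (fun u => evenKernel 0 u - u ^ (-(1 / 2 : ℝ))) u with hH
  set Hc : ℝ → ℂ := fun u => ((H u : ℝ) : ℂ) with hHc
  set V : ℂ := 2 * completedRiemannZeta₀ 1 + ((Real.log z.im - 2 + 2 / Real.sqrt z.im : ℝ) : ℂ) with hV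
  have hHm : HasMellin Hc (1 / 2) V := hasMellin_H hy hH
  -- the two copies of `H_y` inside `f̃_z`
  set L₁ : ℝ → ℂ := fun t => Hc (z.im⁻¹ * t) with hL₁
  set P₂ : ℝ → ℂ := fun t => ((t⁻¹ : ℝ) : ℂ) * L₁ t⁻¹ with hP₂
  have hL₁conv : MellinConvergent L₁ (1 / 2) := (MellinConvergent.comp_mul_left (inv_pos.2 hy)).2 hHm.1
  have hL₁m : mellin L₁ (1 / 2) = (Real.sqrt z.im : ℂ) * V := by
    rw [hL₁, mellin_comp_inv_mul Hc hy, hHm.2]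
  have hP₂conv : MellinConvergent P₂ (1 / 2) := by
    have e : P₂ = fun t : ℝ => (t : ℂ) ^ (-1 : ℂ) • (fun u => L₁ (u ^ (-1 : ℝ))) t := by
      funext t
      simp only [hP₂]
      rw [Complex.cpow_neg_one, smul_eq_mul, Complex.ofReal_inv, Real.rpow_neg_one]
    rw [e, MellinConvergent.cpow_smul, MellinConvergent.comp_rpow (by norm_num : (-1 : ℝ) ≠ 0)]
    have h12 : ((1 : ℂ) / 2 + -1) / ((-1 : ℝ) : ℂ) = 1 / 2 := by push_cast; norm_num
    rw [h12]
    exact hL₁conv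
  have hP₂m : mellin P₂ (1 / 2) = mellin L₁ (1 / 2) := mellin_inv_mul_comp_inv L₁
  -- the theta pair and the remainder
  set Pθ := thetaFEPair z with hPθ
  have hconvθ : MellinConvergent Pθ.f_modif (1 / 2) := (Pθ.isStrongFEPair_toStrongFEPair.hasMellin (1 / 2)).1
  set Cc : ℝ → ℂ := fun t => Pθ.f_modif t - L₁ t - P₂ t with hCc
  have hCconv : MellinConvergent Cc (1 / 2) := (hasMellin_sub (hasMellin_sub hconvθ hL₁conv).1 hP₂conv).1
  -- `mellin f̃ = mellin Cc + mellin L₁ + mellin P₂`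
  have hdecomp : mellin Pθ.f_modif (1 / 2) = mellin Cc (1 / 2) + (Real.sqrt z.im : ℂ) * V +
      (Real.sqrt z.im : ℂ) * V := by
    have h1 := hasMellin_add hCconv hL₁conv
    have h2 := hasMellin_add h1.1 hP₂conv
    have e : (fun t => Cc t + L₁ t + P₂ t) = Pθ.f_modif := by
      funext t; simp only [hCc]; ring
    rw [e] at h2
    rw [h2.2, h1.2, hP₂m, hL₁m]
  -- the remainder is the cross-term series: a.e. identification of its Mellin integrand
  set G : ℝ → ℝ := fun t => ∑' p : ℕ × ℕ, 4 * Real.sqrt z.im * (t⁻¹ * Real.exp (-(Real.pi * z.im *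
      ((p.1 : ℝ) + 1) ^ 2 * t + Real.pi * z.im * ((p.2 : ℝ) + 1) ^ 2 * t⁻¹))) *
        Real.cos (2 * Real.pi * z.re * ((p.1 : ℝ) + 1) * ((p.2 : ℝ) + 1)) with hG
  have hae : ∀ᵐ t : ℝ ∂(volume.restrict (Ioi (0 : ℝ))),
      ((t : ℝ) : ℂ) ^ ((1 / 2 : ℂ) - 1) • Cc t = ((G t : ℝ) : ℂ) := by
    filter_upwards [ae_ne_two_points 1, ae_restrict_mem measurableSet_Ioi] with t ht ht0
    have ht0 : (0 : ℝ) < t := ht0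
    have hre := re_f_modif_decomposition z hH ht0 ht.1
    have hpow : ((t : ℝ) : ℂ) ^ ((1 / 2 : ℂ) - 1) = ((t ^ ((1 / 2 : ℝ) - 1) : ℝ) : ℂ) := by
      rw [show (1 / 2 : ℂ) - 1 = (((1 / 2 : ℝ) - 1 : ℝ) : ℂ) by push_cast; ring, Complex.ofReal_cpow ht0.le]
    have hCt : Cc t = ((4 * Real.sqrt (z.im / t) * ∑' p : ℕ × ℕ,
        Real.exp (-Real.pi * z.im * (t * ((p.1 : ℝ) + 1) ^ 2 + ((p.2 : ℝ) + 1) ^ 2 / t)) *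
          Real.cos (2 * Real.pi * z.re * ((p.1 : ℝ) + 1) * ((p.2 : ℝ) + 1)) : ℝ) : ℂ) := by
      simp only [hCc, hP₂, hL₁, hHc, hPθ]
      rw [f_modif_thetaFEPair_eq_ofReal z t, hre, div_eq_inv_mul, one_div, mul_inv_rev]
      push_cast
      ring
    rw [hpow, hCt, smul_eq_mul, ← Complex.ofReal_mul]
    congr 1
    simp only [hG]
    rw [← tsum_mul_left, ← tsum_mul_left]
    refine tsum_congr fun p => ?_
    exact cross_term_eq ht0 p.1 p.2 _
  have hCm : mellin Cc (1 / 2) = ((∫ t in Ioi (0 : ℝ), G t : ℝ) : ℂ) := by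
    unfold mellin
    rw [integral_congr_ae hae]
    exact integral_ofReal
  -- Fubini for the cross terms
  have hGint : ∫ t in Ioi (0 : ℝ), G t = 4 * Real.sqrt z.im * S := by
    have hF := fun p : ℕ × ℕ => cross_term_integral hy p.1 p.2
      (Real.cos (2 * Real.pi * z.re * ((p.1 : ℝ) + 1) * ((p.2 : ℝ) + 1)))
    have hswap := integral_tsum_of_summable_integral_norm (μ := volume.restrict (Ioi (0 : ℝ)))
      (F := fun (p : ℕ × ℕ) (t : ℝ) => 4 * Real.sqrt z.im * (t⁻¹ * Real.exp (-(Real.pi * z.im *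
        ((p.1 : ℝ) + 1) ^ 2 * t + Real.pi * z.im * ((p.2 : ℝ) + 1) ^ 2 * t⁻¹))) *
          Real.cos (2 * Real.pi * z.re * ((p.1 : ℝ) + 1) * ((p.2 : ℝ) + 1)))
      (fun p => (hF p).1) ?_
    · simp only [hG]
      rw [← hswap, hS, ← tsum_mul_left]
      refine tsum_congr fun p => ?_
      rw [(hF p).2.1]
      ring
    · refine (summable_cross_norms hy z.re).congr fun p => ?_
      exact ((hF p).2.2).symm
  -- real parts
  have hhalf : ((1 / 2 : ℝ) : ℂ) = 1 / 2 := by push_cast; rfl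
  have hΛ₀ : (Pθ.Λ₀ ((1 / 2 : ℝ) : ℂ)).re = 4 * Real.sqrt z.im * S +
      2 * Real.sqrt z.im * (2 + Real.eulerMascheroniConstant - Real.log (4 * Real.pi) +
        (Real.log z.im - 2 + 2 / Real.sqrt z.im)) := by
    rw [hhalf, show Pθ.Λ₀ (1 / 2) = mellin Pθ.f_modif (1 / 2) from rfl, hdecomp, hCm, hGint, hV]
    have e2 : ((4 * Real.sqrt z.im * S : ℝ) : ℂ) + (Real.sqrt z.im : ℂ) * (2 * completedRiemannZeta₀ 1 +
        ((Real.log z.im - 2 + 2 / Real.sqrt z.im : ℝ) : ℂ)) + (Real.sqrt z.im : ℂ) *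
          (2 * completedRiemannZeta₀ 1 + ((Real.log z.im - 2 + 2 / Real.sqrt z.im : ℝ) : ℂ)) =
        ((4 * Real.sqrt z.im * S : ℝ) : ℂ) + ((2 * Real.sqrt z.im : ℝ) : ℂ) *
          (2 * completedRiemannZeta₀ 1 + ((Real.log z.im - 2 + 2 / Real.sqrt z.im : ℝ) : ℂ)) := by
      push_cast; ring
    rw [e2, Complex.add_re, Complex.ofReal_re, Complex.re_ofReal_mul, Complex.add_re,
      re_two_mul_completedRiemannZeta₀_one, Complex.ofReal_re]
  rw [re_Λ_ofReal, hΛ₀]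
  have key : 2 * Real.sqrt z.im * (2 / Real.sqrt z.im) = 4 := by
    field_simp; norm_num
  norm_num
  nlinarith [key]


end Literature.Barriers.RiemannHypothesis
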